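import Summits.NavierStokesRegularity.NavierStokesRegularity.Theorems.RungBlowupCofinal.ToroidalLift
import Summits.NavierStokesRegularity.FluidComputer.AngularGalerkinLadderBasics
import HarnessLib

/-!
# Convective letters of the three-lift ansatz: advection of the gradient lift `a(‖·‖²)∇ψ` and of
# the radial lift `b(‖·‖²)ψx` by any field, and the SWIRL–WAVE COUPLING
# `(V·∇)W + (W·∇)V = Ω(2e₃ × W − J₃W) + 2Ω′⟪y, W⟫ e₃ × y` for the zonal swirl `V = Ω(‖y‖²) e₃ × y`
# (route `AngularGalerkinLadder`, crux K1 `RungBlowupCofinal`; kinematic helper, theorems only)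

Cell `ns-blowup`, seat `ns-blowup-circuit` (g12, AGL Lean seat). Helper file for
`stmt-NavierStokesRegularity-19959` serving `Cruxes/RungBlowupCofinal/Lines/qlwave.lean`, card support
target **(S5)** (the NONLINEAR letters of the mean–wave system on the three-lift ansatz
`U = a(‖x‖²)∇φ + b(‖x‖²)φx + c(‖x‖²)x × ∇φ`). Companion of `SectoralReynoldsStress.lean`
(`convect_toroidalLift`, the toroidal member; the sectoral Reynolds stress in closed form).

* `convect_gradientLift`: `(u·∇)(a(‖·‖²)∇ψ)(y) = a(‖y‖²)·D(∇ψ)(y)u(y) + 2a′(‖y‖²)⟪y, u(y)⟫·∇ψ(y)`;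
* `convect_radialLift`: `(u·∇)(b(‖·‖²)ψ·)(y) = b(‖y‖²)·(ψ(y)u(y) + Dψ(y)u(y)·y) + 2b′(‖y‖²)⟪y,u(y)⟫ψ(y)·y`;
* **`swirl_wave_coupling`**: for the ZONAL SWIRL `V(y) = Ω(‖y‖²)·e₃ × y` (the toroidal lift of the
  zonal solid harmonic `z₁ = y₂`, the streak/solid-rotation member of the zonal class) and ANY
  differentiable `W`:
  `(V·∇)W(y) + (W·∇)V(y) = Ω(‖y‖²)·(2 e₃ × W(y) − (J₃W)(y)) + 2Ω′(‖y‖²)⟪y, W(y)⟫·e₃ × y`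
  (`J₃ = angGen 2`; the transport part of `(V·∇)W` IS `−Ω J₃W` up to the spin term). Hence in the
  wave equation `AW + αJ₃W + (V·∇)W + (W·∇)V + … ` a swirl acts as the DOPPLER SHIFT `α ↦ α − Ω`
  of the precession rate plus the Coriolis-type term `2Ω e₃ × W` plus a radial-shear term — the
  dictionary «wave phase speed ↦ precession rate» of the card's ## Transfer made a kernel identity;
  for a tangential wave (`⟪y, W⟫ = 0`, e.g. every toroidal wave) the shear term drops
  (`swirl_wave_coupling_of_tangential`), and for an `n`-fold wave with `J₃W = nW'` the coupling is
  `Ω(2e₃ × W − nW')` (`swirl_wave_coupling_of_wave`).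

LABEL: KERNEL kinematics (product rules). Nothing here asserts a Theses declaration; no definition,
no named fact, no sorry. WHAT THIS IS NOT: not Navier–Stokes evidence; not a profile; the
Clebsch–Gordan decomposition of the bilinear letters `D(∇ψ)∇φ`, `φ∇ψ`, … into three-lifts (the
rest of (S5)) needs the harmonic (Fischer) decomposition of polynomial fields, not in the tree.
References: [cite: BullardGellman1954]; [cite: MajdaBertozziCUP2002, §1.1 (vector identities)].
-/

noncomputable section

namespace Summit.NavierStokesRegularity.AngularGalerkinLadderConvectiveLiftLetters

open Set Function
open scoped ContDiff RealInnerProductSpace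
open Literature.Analysis.FluidPDE
open Summit.NavierStokesRegularity.FluidComputer
open Summit.NavierStokesRegularity.FluidComputer.AngularLadder

variable {ψ : EuclideanSpace ℝ (Fin 3) → ℝ} {a b Ω : ℝ → ℝ}
  {u W : EuclideanSpace ℝ (Fin 3) → EuclideanSpace ℝ (Fin 3)}

/-- The derivative of a radial profile: `D(a(‖·‖²))(y) w = a′(‖y‖²) · 2⟪y, w⟫`. [folklore] -/
private theorem fderiv_radial_apply' (ha : Differentiable ℝ a) (y w : EuclideanSpace ℝ (Fin 3)) :
    fderiv ℝ (fun x : EuclideanSpace ℝ (Fin 3) => a (‖x‖ ^ 2)) y w =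
      deriv a (‖y‖ ^ 2) * (2 * ⟪y, w⟫) := by
  have h : HasFDerivAt (fun x : EuclideanSpace ℝ (Fin 3) => a (‖x‖ ^ 2))
      (deriv a (‖y‖ ^ 2) • (2 : ℕ) • innerSL ℝ y) y :=
    ((ha (‖y‖ ^ 2)).hasDerivAt).comp_hasFDerivAt y (hasStrictFDerivAt_norm_sq y).hasFDerivAt
  rw [h.fderiv]
  simp

/-- A radial profile is differentiable as a function on `ℝ³`. [folklore] -/
private theorem differentiableAt_radial (ha : Differentiable ℝ a) (y : EuclideanSpace ℝ (Fin 3)) :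
    DifferentiableAt ℝ (fun x : EuclideanSpace ℝ (Fin 3) => a (‖x‖ ^ 2)) y :=
  (ha (‖y‖ ^ 2)).comp y ((hasStrictFDerivAt_norm_sq y).hasFDerivAt.differentiableAt)

/-! ## §1 Advection of the gradient lift and of the radial lift by any field -/

/-- **Advection of a radially modulated gradient lift by any field**: for differentiable `a`, a
differentiable field `∇ψ` and any `u`,
`(u·∇)(a(‖·‖²)∇ψ)(y) = a(‖y‖²) · D(∇ψ)(y) u(y) + 2a′(‖y‖²)⟪y, u(y)⟫ · ∇ψ(y)`. [folklore] -/
theorem convect_gradientLift (ha : Differentiable ℝ a) (hψ : Differentiable ℝ (gradient ψ))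
    (u : EuclideanSpace ℝ (Fin 3) → EuclideanSpace ℝ (Fin 3)) (y : EuclideanSpace ℝ (Fin 3)) :
    convect u (fun x => a (‖x‖ ^ 2) • gradient ψ x) y =
      a (‖y‖ ^ 2) • fderiv ℝ (gradient ψ) y (u y) +
        (deriv a (‖y‖ ^ 2) * (2 * ⟪y, u y⟫)) • gradient ψ y := by
  rw [convect_apply, fderiv_fun_smul (differentiableAt_radial ha y) (hψ y)]
  simp only [_root_.add_apply, _root_.smul_apply, ContinuousLinearMap.smulRight_apply,
    fderiv_radial_apply' ha]

/-- **Advection of a radially modulated radial lift by any field**: for differentiable `b`, `ψ`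
and any `u`,
`(u·∇)(b(‖·‖²)ψ·)(y) = b(‖y‖²)·(ψ(y) u(y) + Dψ(y)u(y) · y) + 2b′(‖y‖²)⟪y, u(y)⟫ψ(y) · y`.
[folklore] -/
theorem convect_radialLift (hb : Differentiable ℝ b) (hψ : Differentiable ℝ ψ)
    (u : EuclideanSpace ℝ (Fin 3) → EuclideanSpace ℝ (Fin 3)) (y : EuclideanSpace ℝ (Fin 3)) :
    convect u (fun x : EuclideanSpace ℝ (Fin 3) => b (‖x‖ ^ 2) • (ψ x • x)) y =
      b (‖y‖ ^ 2) • (ψ y • u y + (fderiv ℝ ψ y (u y)) • y) +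
        (deriv b (‖y‖ ^ 2) * (2 * ⟪y, u y⟫) * ψ y) • y := by
  have hSd : DifferentiableAt ℝ (fun x : EuclideanSpace ℝ (Fin 3) => ψ x • x) y :=
    (hψ y).smul differentiableAt_fun_id
  have hD : ∀ w, fderiv ℝ (fun x : EuclideanSpace ℝ (Fin 3) => ψ x • x) y w =
      ψ y • w + (fderiv ℝ ψ y w) • y := fun w => by
    rw [fderiv_fun_smul (hψ y) differentiableAt_fun_id]
    simp
  rw [convect_apply, fderiv_fun_smul (differentiableAt_radial hb y) hSd]
  simp only [_root_.add_apply, _root_.smul_apply, ContinuousLinearMap.smulRight_apply, hD,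
    fderiv_radial_apply' hb, smul_smul]

/-! ## §2 The swirl–wave coupling -/

/-- The derivative of the zonal swirl `V(y) = Ω(‖y‖²) e₃ × y`:
`DV(y) w = Ω(‖y‖²) e₃ × w + 2Ω′(‖y‖²)⟪y, w⟫ e₃ × y`. [folklore] -/
theorem fderiv_swirl_apply (hΩ : Differentiable ℝ Ω) (y w : EuclideanSpace ℝ (Fin 3)) :
    fderiv ℝ (fun x : EuclideanSpace ℝ (Fin 3) => Ω (‖x‖ ^ 2) • cross (axis 2) x) y w =
      Ω (‖y‖ ^ 2) • cross (axis 2) w + (deriv Ω (‖y‖ ^ 2) * (2 * ⟪y, w⟫)) • cross (axis 2) y := by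
  have hC : DifferentiableAt ℝ (fun x : EuclideanSpace ℝ (Fin 3) => cross (axis 2) x) y :=
    (crossCLM (axis 2)).differentiableAt
  rw [fderiv_fun_smul (differentiableAt_radial hΩ y) hC]
  simp only [_root_.add_apply, _root_.smul_apply, ContinuousLinearMap.smulRight_apply,
    fderiv_radial_apply' hΩ]
  rw [show (fun x : EuclideanSpace ℝ (Fin 3) => cross (axis 2) x) = fun x => crossCLM (axis 2) x
    from rfl, (crossCLM (axis 2)).fderiv, crossCLM_apply]

/-- The zonal swirl is differentiable. [folklore] -/
theorem differentiable_swirl (hΩ : Differentiable ℝ Ω) :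
    Differentiable ℝ fun x : EuclideanSpace ℝ (Fin 3) => Ω (‖x‖ ^ 2) • cross (axis 2) x :=
  fun y => (differentiableAt_radial hΩ y).smul (crossCLM (axis 2)).differentiableAt

/-- **THE SWIRL–WAVE COUPLING.** For the zonal swirl `V(y) = Ω(‖y‖²) e₃ × y` (differentiable
`Ω`) and ANY field `W` (both sides read `DW` through `fderiv`):
`(V·∇)W(y) + (W·∇)V(y) = Ω(‖y‖²)·(2 e₃ × W(y) − (J₃W)(y)) + 2Ω′(‖y‖²)⟪y, W(y)⟫ · e₃ × y` —
the advection of the wave by the swirl is `Ω(e₃ × W − J₃W)` (definition of the generator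
`J₃W = e₃ × W − DW(e₃ × y)`), the advection of the swirl by the wave is the Coriolis-type
`Ω e₃ × W` plus the radial-shear term. In the wave equation this is the Doppler shift `α ↦ α − Ω`
of the precession rate. [folklore] -/
theorem swirl_wave_coupling (hΩ : Differentiable ℝ Ω) (W : EuclideanSpace ℝ (Fin 3) → EuclideanSpace ℝ (Fin 3))
    (y : EuclideanSpace ℝ (Fin 3)) :
    convect (fun x : EuclideanSpace ℝ (Fin 3) => Ω (‖x‖ ^ 2) • cross (axis 2) x) W y +
        convect W (fun x : EuclideanSpace ℝ (Fin 3) => Ω (‖x‖ ^ 2) • cross (axis 2) x) y =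
      Ω (‖y‖ ^ 2) • ((2 : ℝ) • cross (axis 2) (W y) - angGen 2 W y) +
        (deriv Ω (‖y‖ ^ 2) * (2 * ⟪y, W y⟫)) • cross (axis 2) y := by
  rw [convect_apply, convect_apply, fderiv_swirl_apply hΩ, map_smul, angGen_eq]
  simp only [crossCLM_apply]
  module

/-- **Swirl–wave coupling for a TANGENTIAL wave** (`⟪y, W(y)⟫ = 0`, e.g. every toroidal field
`c(‖y‖²) y × G(y)`): the radial-shear term drops,
`(V·∇)W + (W·∇)V = Ω(‖y‖²)·(2 e₃ × W − J₃W)`. [folklore] -/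
theorem swirl_wave_coupling_of_tangential (hΩ : Differentiable ℝ Ω)
    (htan : ∀ y, ⟪y, W y⟫ = 0) (y : EuclideanSpace ℝ (Fin 3)) :
    convect (fun x : EuclideanSpace ℝ (Fin 3) => Ω (‖x‖ ^ 2) • cross (axis 2) x) W y +
        convect W (fun x : EuclideanSpace ℝ (Fin 3) => Ω (‖x‖ ^ 2) • cross (axis 2) x) y =
      Ω (‖y‖ ^ 2) • ((2 : ℝ) • cross (axis 2) (W y) - angGen 2 W y) := by
  rw [swirl_wave_coupling hΩ W, htan y, mul_zero, mul_zero, zero_smul, add_zero]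

/-- **Swirl–wave coupling for an `n`-fold tangential wave with quadrature companion `W'`**
(`J₃W = n W'`, e.g. the sectoral toroidal wave, `SectoralReynoldsStress.angGen_two_toroidalSectoral`):
`(V·∇)W + (W·∇)V = Ω(‖y‖²)·(2 e₃ × W − n W')`. [folklore] -/
theorem swirl_wave_coupling_of_wave (hΩ : Differentiable ℝ Ω)
    (htan : ∀ y, ⟪y, W y⟫ = 0) {W' : EuclideanSpace ℝ (Fin 3) → EuclideanSpace ℝ (Fin 3)} {n : ℝ}
    (hconj : ∀ y, angGen 2 W y = n • W' y) (y : EuclideanSpace ℝ (Fin 3)) :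
    convect (fun x : EuclideanSpace ℝ (Fin 3) => Ω (‖x‖ ^ 2) • cross (axis 2) x) W y +
        convect W (fun x : EuclideanSpace ℝ (Fin 3) => Ω (‖x‖ ^ 2) • cross (axis 2) x) y =
      Ω (‖y‖ ^ 2) • ((2 : ℝ) • cross (axis 2) (W y) - n • W' y) := by
  rw [swirl_wave_coupling_of_tangential hΩ htan, hconj y]

/-- **The swirl is zonal**: `J₃V = 0` for `V(y) = Ω(‖y‖²) e₃ × y` (`e₃ × (e₃ × y) − D V(y)(e₃ × y)
= 0`). [folklore] -/
theorem angGen_two_swirl (hΩ : Differentiable ℝ Ω) (y : EuclideanSpace ℝ (Fin 3)) :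
    angGen 2 (fun x : EuclideanSpace ℝ (Fin 3) => Ω (‖x‖ ^ 2) • cross (axis 2) x) y = 0 := by
  have h0 : ⟪y, cross (axis 2) y⟫ = 0 := by
    simp only [cross, PiLp.inner_apply, cross_apply, RCLike.inner_apply, conj_trivial,
      Fin.sum_univ_three, Matrix.cons_val_zero, Matrix.cons_val_one, Matrix.cons_val_two,
      Matrix.head_cons, Matrix.tail_cons]
    ring
  rw [angGen_eq]
  simp only [crossCLM_apply, fderiv_swirl_apply hΩ, h0, mul_zero, zero_smul, add_zero]
  rw [show cross (axis 2) (Ω (‖y‖ ^ 2) • cross (axis 2) y) = Ω (‖y‖ ^ 2) • cross (axis 2) (cross (axis 2) y)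
    by rw [← crossCLM_apply, map_smul, crossCLM_apply], sub_self]

/-- **The swirl is tangential and solenoidal in the radial direction**: `⟪y, V(y)⟫ = 0`. [folklore] -/
theorem inner_self_swirl (Ω : ℝ → ℝ) (y : EuclideanSpace ℝ (Fin 3)) :
    ⟪y, Ω (‖y‖ ^ 2) • cross (axis 2) y⟫ = 0 := by
  rw [inner_smul_right]
  have h0 : ⟪y, cross (axis 2) y⟫ = 0 := by
    simp only [cross, PiLp.inner_apply, cross_apply, RCLike.inner_apply, conj_trivial,
      Fin.sum_univ_three, Matrix.cons_val_zero, Matrix.cons_val_one, Matrix.cons_val_two,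
      Matrix.head_cons, Matrix.tail_cons]
    ring
  rw [h0, mul_zero]

end Summit.NavierStokesRegularity.AngularGalerkinLadderConvectiveLiftLetters

end
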